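import Mathlib
import HarnessLib
import HarnessLib.Audit
import Summits.SmoothPoincare4.Statement
import Literature.Topology.FourManifolds.HomotopySpheres
import Literature.Topology.FourManifolds.ConnectedSum
import Literature.Topology.FourManifolds.TwistedSpheres
import Literature.Geometry.Lorentzian.PseudoRiemannianMetric
import Literature.Geometry.Lorentzian.LeviCivita
import Literature.Geometry.Lorentzian.Geodesic
import Literature.Topology.FourManifolds.HomotopyS4CompactProofs
import Literature.Topology.FourManifolds.HomotopyS4OrientableProofs
import HarnessLib.Audit.Status.Attr

/-!
Route: TransparentBalls

DORMANT since 2026-08-22T17:35:49Z (reconciler: no traction for 5.5 d (last activity item-evidence-added at 2026-08-17T04:19:21Z); parked, not closed — `ledger route dormant route-SmoothPoincare4-TransparentBalls --off` to reactivate) — unstaffed, not closed; items shared with open routes are served there. `ledger route dormant <id> --off` reactivates.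

# Route TransparentBalls — Fake 4-balls trap light — transparent punctured homotopy 4-spheres are
standard, and every puncture can be made transparent

X = RIGID_Σ ∧ TRANSP_Σ ("it suffices to show X"; realises card fake-balls-trap-light, whose X =
RIGID₄ ∧ TRANSP). Fix a homotopy
4-sphere Σ, a Riemannian metric g on Σ (tree: `PseudoRiemannianMetric (𝓡 4) ∞ …` + `IsRiemannian` +
`[g.HasLeviCivita]`), a closed
ROUND CHART BALL E = (extChartAt p)⁻¹(closedBall r) and a smooth defining function ρ with {0 ≤ ρ} =
E, 0 a regular value. The
PUNCTURE D = {ρ ≤ 0} = Σ ∖ E° is TRANSPARENT for g if ∂D is strictly convex (Hess_g ρ(v,v) > 0 for 0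
≠ v ∈ ker dρ on ∂D — PSU
Lemma 3.1.12 with the sign of ρ flipped) and non-trapping (every complete geodesic with γ(0) ∈ D,
γ'(0) ≠ 0 reaches {ρ > 0} at some
t > 0; PSU Def 3.1.3). RIGID_Σ (TransparentSpheresStandard): a homotopy 4-sphere with a transparent
puncture is diffeomorphic to S⁴.
TRANSP_Σ (PuncturedSpheresTransparent): every homotopy 4-sphere admits g, p, r, ρ making the
puncture transparent. Since a transparent
compact 4-manifold is contractible with simply connected boundary (PSU Prop 3.7.22 + the card's
retraction SM ≃ ∂₊SM; support
TransparentDomainContractible), RIGID_Σ is the card's RIGID₄ ("transparent compact 4-manifolds are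
B⁴") written inside the closed
manifold (Perelman, Palais and Cerf Γ₄ = 0 absorbed into the conclusion `≃ₘ S⁴`), and SPC4 ⟺ RIGID_Σ
∧ TRANSP_Σ (⇐ is the Assembly;
⇒ because S⁴ minus a cap carries the flat-ball metric). The removed piece being a CHART ball is
load-bearing: were D allowed to be
a tiny convex ball the statement would collapse to SPC4 itself.
Lean: `(∀ (S : Literature.Topology.FourManifolds.HomotopySphere 4) (g :
Literature.Geometry.Lorentzian.PseudoRiemannianMetric (𝓡 4) ∞ (EuclideanSpace ℝ (Fin 4))
(TangentSpace (𝓡 4) : S.carrier → Type _)) [g.HasLeviCivita] (p : S.carrier) (r : ℝ) (ρ : S.carrier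
→ ℝ), g.IsRiemannian → ContMDiff (𝓡 4) 𝓘(ℝ, ℝ) ∞ ρ → 0 < r → Metric.closedBall (extChartAt (𝓡 4) p
p) r ⊆ (extChartAt (𝓡 4) p).target → {x | 0 ≤ ρ x} = (extChartAt (𝓡 4) p).symm '' Metric.closedBall
(extChartAt (𝓡 4) p p) r → (∀ x, ρ x = 0 → mfderiv (𝓡 4) 𝓘(ℝ, ℝ) ρ x ≠ 0) → (∀ x, ρ x = 0 → ∀ v :
TangentSpace (𝓡 4) x, v ≠ 0 → mfderiv (𝓡 4) 𝓘(ℝ, ℝ) ρ x v = 0 → 0 < g.hessian ρ x v v) → (∀ γ : ℝ →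
S.carrier, Literature.Geometry.Lorentzian.IsGeodesic g.leviCivita γ → ρ (γ 0) ≤ 0 →
Literature.Geometry.Lorentzian.velocity (𝓡 4) γ 0 ≠ 0 → ∃ t : ℝ, 0 < t ∧ 0 < ρ (γ t)) → Nonempty
(S.carrier ≃ₘ⟮𝓡 4, 𝓡 4⟯ Metric.sphere (0 : EuclideanSpace ℝ (Fin 5)) 1)) ∧ (∀ S :
Literature.Topology.FourManifolds.HomotopySphere 4, ∃ (g :
Literature.Geometry.Lorentzian.PseudoRiemannianMetric (𝓡 4) ∞ (EuclideanSpace ℝ (Fin 4))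
(TangentSpace (𝓡 4) : S.carrier → Type _)) (_ : g.HasLeviCivita) (p : S.carrier) (r : ℝ) (ρ :
S.carrier → ℝ), g.IsRiemannian ∧ ContMDiff (𝓡 4) 𝓘(ℝ, ℝ) ∞ ρ ∧ 0 < r ∧ Metric.closedBall (extChartAt
(𝓡 4) p p) r ⊆ (extChartAt (𝓡 4) p).target ∧ {x | 0 ≤ ρ x} = (extChartAt (𝓡 4) p).symm ''
Metric.closedBall (extChartAt (𝓡 4) p p) r ∧ (∀ x, ρ x = 0 → mfderiv (𝓡 4) 𝓘(ℝ, ℝ) ρ x ≠ 0) ∧ (∀ x,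
ρ x = 0 → ∀ v : TangentSpace (𝓡 4) x, v ≠ 0 → mfderiv (𝓡 4) 𝓘(ℝ, ℝ) ρ x v = 0 → 0 < g.hessian ρ x v
v) ∧ (∀ γ : ℝ → S.carrier, Literature.Geometry.Lorentzian.IsGeodesic g.leviCivita γ → ρ (γ 0) ≤ 0 →
Literature.Geometry.Lorentzian.velocity (𝓡 4) γ 0 ≠ 0 → ∃ t : ℝ, 0 < t ∧ 0 < ρ (γ t)))`

## Assembly
Pure glue, PROVED by the planner (folder Sketch2.lean, `theorem assembly_holds : Assembly`, rc 0,
axioms propext/Classical.choice/Quot.sound):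
`intro hR hT; refine Literature.SPC4.smoothPoincare4_of_forall_homotopySphere
compactSpace_of_homotopyEquiv_sphere_four_holds
isOrientable_of_homotopyEquiv_sphere_four_holds ?_; intro S; obtain ⟨g, hLC, p, r, ρ, h1, …, h8⟩ :=
hT S; haveI := hLC; exact hR S g p r ρ h1 … h8`
(reduction Theorems/PICReduction.lean + the two proved packaging facts HomotopyS4CompactProofs /
HomotopyS4OrientableProofs). No named fact
enters the assembly; Perelman/Palais/Cerf live inside TransparentSpheresStandard's conclusion.

Rationale: WHY THIS LINE. Transparency (no trapped light + convex walls) is a DYNAMICAL property of a compact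
Riemannian 4-manifold that already sees smooth
4-topology invisible to homotopy type: by PaternainSaloUhlmann2023 Prop 3.7.22 (Serre 1951 /
Thorbergsson 1978) plus the retraction of
the unit sphere bundle onto its inward boundary, a transparent compact M⁴ is contractible with
homotopy-S³ boundary — so B⁴ presented as
0h ∪ 1h ∪ 2h is transparent while the Mazur/Akbulut cork with the same handle count traps in EVERY
convex metric, and knot traces,
punctured ℂP², anything with H₂ ≠ 0 trap. Dimension 4 (with 5) is the only dimension where
"transparent ⇒ ball" is open (n ≤ 3:
disc/ball; n ≥ 6: h-cobordism), and homotopy 4-balls are exactly its residue; the route files that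
residue as RIGID_Σ and its
existence half TRANSP_Σ. Imported area: geometric inverse problems / geodesic dynamics — exit-time
regularity and escape functions
(PaternainSaloUhlmann2023 Lemma 3.2.3, Prop 3.3.1: non-trapping ⟺ ∃ f ∈ C^∞(SM) with X f > 0),
simple ⇒ ball (Prop 3.8.5), lens/
scattering rigidity (StefanovUhlmannVasy2021 = arXiv:1702.03638, Guillarmou2016 = arXiv:1412.1760,
CrokeHerreros2016 = arXiv:1108.4938)
and reconstruction of a manifold's topology from scattering data (LassasSaksalaZhou2018 =
arXiv:1708.07573) — none of which has been
pointed at a question whose unknown is the diffeomorphism type of the filling. Escape functions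
grade transparency by their degree in
the velocity: degree 1 (f = g(V,γ')) means an outward g-EXPANDING vector field (g(∇_wV,w) > 0), and
that rung is provably rigid
(support ExpandingFieldTwisted: contraction of the intrinsic metric under −V gives a unique source
and a flow-out collar, so D ≅ B⁴ and Σ
is a twisted sphere) — RIGID_Σ is the claim that arbitrary degree is as rigid as degree 1. No other
SPC4 route or card uses geodesic
dynamics: PIC / WeylBudget / RicciTranscript / ricci-fat-homotopy-balls are curvature conditions,
EntropyLadder / minimal-s3 /
bh-two-convex-sweepouts are codimension-one parabolic flows, ConvexityLadder is extrinsic; the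
negatives index is empty.

RANKED CRUXES. #0 TransparencyThesis (target) — X = RIGID_Σ ∧ TRANSP_Σ, both conjuncts spelled out
(the two crux bodies below, verbatim). (why it might fail: each conjunct is a consequence of SPC4,
so X ⟺ SPC4: the split is honest but cannot be easier than the summit in total; its value is that
the two halves belong to different communities (4-manifolds vs inverse problems).)
[PaternainSaloUhlmann2023, Kirby1997, Cerf1968, FreedmanJDG1982]
#2 TransparentSpheresStandard (crux) — RIGID_Σ (card RIGID₄): for every homotopy 4-sphere Σ,
Riemannian g with Levi-Civita connection, point p, radius r > 0 with closedBall(chart p p, r) ⊆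
chart target, and smooth ρ with {0 ≤ ρ} = chart-preimage of that closed ball, 0 a regular value of
ρ, ∂D = {ρ = 0} strictly convex from D = {ρ ≤ 0} (Hess_g ρ > 0 on ker dρ) and D non-trapping (every
complete geodesic starting in D with nonzero velocity reaches {ρ > 0} in positive time) — Σ is
diffeomorphic to S⁴. [difficulty: open-problem] (why it might fail: non-trapping + convex is C²-open
and no obstruction beyond 'contractible, ∂ ≃ S³' is known: an exotic homotopy ball, if any exists,
may simply carry a transparent metric (then RIGID_Σ is false and TRANSP_Σ true).)
[PaternainSaloUhlmann2023, StefanovUhlmannVasy2021, Guillarmou2016, Cerf1968, FreedmanJDG1982]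
#3 PuncturedSpheresTransparent (crux) — TRANSP_Σ (card TRANSP): every homotopy 4-sphere Σ admits a
Riemannian metric g (with Levi-Civita connection), a point p, a radius r and a smooth ρ satisfying
exactly the hypotheses of TransparentSpheresStandard: co-ball {0 ≤ ρ} = chart-preimage of
closedBall(chart p p, r) ⊆ target, 0 regular, ∂D strictly g-convex, D = {ρ ≤ 0} non-trapping. True
for Σ = S⁴ (pull the flat unit-ball metric back to S⁴ minus a cap and extend). [difficulty:
open-problem] (why it might fail: conversely every convex metric on an exotic puncture might trap —
transparency could be as strong as a diffeomorphism to B⁴ (its degree-1 rung provably is: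
ExpandingFieldTwisted) — making TRANSP_Σ ⟺ SPC4 and RIGID_Σ vacuous.) [PaternainSaloUhlmann2023,
CrokeHerreros2016, Kirby1997]
#4 TransparentSpheresSelfInverse (crux) — DOUBLE (card item 3(a), weaker than RIGID_Σ): under the
hypotheses of TransparentSpheresStandard, S⁴ is a connected sum Σ # Σ (tree `IsConnectedSum`,
unoriented, existential over the discs) — realised by the double D ∪_∂ D̄ = Σ # Σ̄ of the
transparent puncture along the removed chart balls. Equivalently D × [0,1] ≅ B⁵; it makes Σ
invertible, i.e. feeds SchoenfliesSplit.SchsplitInvertible with T = Σ, and it is the entry point for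
the 5-dimensional lever (D × I with the convexly smoothed product metric is again transparent).
[deps: TransparentSpheresStandard] [difficulty: open-problem] (why it might fail: dies with RIGID_Σ
in the exotic-transparent scenario; and its own lever needs 'transparent contractible PRODUCT
5-manifolds are B⁵', a RIGID₅ nobody has — the non-trapping billiard on the double gives a
cross-section, not yet a diffeomorphism.) [PaternainSaloUhlmann2023, KervaireMilnor1963,
arXiv:2212.02004]
#9 ExpandingFieldTwisted (support) — DEGREE-1 TRANSPARENCY IS RIGID (calibration of the encoding;
the k = 1 rung of PSU Prop 3.3.1(iii) with escape function f(x,v) = g(V_x, v)): if the puncture D =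
{ρ ≤ 0} (co-ball, 0 regular) carries a smooth vector field V with g(∇_w V, w) > 0 for all x ∈ D, w ≠
0 (½ L_V g positive definite) and dρ(V) > 0 on ∂D (V outward), then Σ is a twisted sphere D⁴ ∪_φ D⁴
(hence ≅ S⁴ by `cerf_twistedSphere_four`, not assumed here). Proof: −V preserves D, contracts
intrinsic lengths by e^(−ct), so ψ_t(D) shrinks to a unique zero x₀ ∈ D°, a nondegenerate source; a
small chart sphere around x₀ is V-transverse and its V-flow-out reaches ∂D transversally in finite
time, so D = ball ∪ collar ≅ D⁴ and Σ = D ∪ E. Boundary convexity is not needed; such (g,V) is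
automatically non-trapping. [difficulty: XL] [PaternainSaloUhlmann2023, Milnor1965,
KervaireMilnor1963]
#9 TransparentDomainContractible (support) — THE CARD'S LEMMA, dimension 4, closed-manifold form
(CORK-TRAP): in any closed smooth Riemannian 4-manifold M, a connected regular sublevel domain D =
{ρ ≤ 0} with strictly convex boundary and no trapped geodesic is contractible and its boundary {ρ =
0} is simply connected (hence a homotopy 3-sphere; so every cork, Mazur manifold, knot trace or
domain with H₂ ≠ 0 traps in every convex metric). Proof: PSU Prop 3.7.22 (Serre: non-contractible ⇒
geodesic chords of unbounded length, contradicting the uniform escape time) gives contractibility;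
the backward flow to the boundary, with exit time continuous by strict convexity (PSU Lemma 3.2.3),
deformation-retracts SD onto ∂₊SD ≃ ∂D, so ∂D → D factors through the S³-bundle SD → D and is
3-connected; hence π₁(∂D) ≅ π₁(D) = 1 and π₂(∂D) = 0, i.e. ∂D is a homotopy 3-sphere (the item
records contractibility and π₁(∂D) = 1). [difficulty: XL] [PaternainSaloUhlmann2023,
StefanovUhlmannVasy2021]

TWO-LAYER PLAN. Foreseen glued splits (k ≤ 3, depth 1; nothing filed now):
TransparentSpheresStandard ⇐ RigidTwisted (transparent puncture ⇒ Σ twisted sphere, i.e. D ≅ D⁴) →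
CerfGammaFour (`cerf_twistedSphere_four`, named fact, unproved in tree) → TransparentSpheresStandard
[as soon as anyone attacks D ≅ B⁴ or Cerf lands];
TransparentSpheresStandard ⇐ NoFocusDeformation (a transparent puncture carries a transparent metric
with a conjugate-free interior viewpoint / unique chords) → SimpleIsTwisted (strictly convex +
unique chords from one interior point ⇒ exp is a diffeomorphism of the closed star-shaped chord
domain onto D, PSU Prop 3.8.5 ⇒ twisted sphere) → TransparentSpheresStandard  [the card's NOFOCUS;
needs Jacobi fields or a chord-uniqueness phrasing];
TransparentSpheresStandard ⇐ TopologicalLensRigidity (two transparent punctures with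
Hamiltonian-isotopic scattering relations on T*S³ are diffeomorphic) → LensClassesRealisedOnBall →
TransparentSpheresStandard  [card L1/L2; needs the scattering-relation definition];
PuncturedSpheresTransparent ⇐ GluckPuncturesTransparent (∀ 2-knots K, the punctured Gluck twist is
transparent; typable now via `IsGluckTwist`) → CappellShaneson/presentation-sphere punctures →
general;
TransparentSpheresSelfInverse ⇐ ProductTransparent (D transparent ⇒ D × [0,1] with convexly rounded
product metric transparent) → RigidFiveProducts (transparent contractible product 5-manifolds are
B⁵) → SelfInverse.

KILL CRITERIA. No crux of this route can be refuted while SPC4 lives: RIGID_Σ, TRANSP_Σ and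
SelfInverse are each consequences of SPC4 (S⁴ minus a
cap with the flat-ball metric is transparent; S⁴ # S⁴ = S⁴), so `closed_as: refuted` on any of them
is an exotic 4-sphere and closes
the route together with the positive side of the summit (close --reason refuted:<Decl>). Independent
triggers: (k1) SOFTNESS — a refuter
or the literature shows every compact contractible D⁴ with ∂D = S³ (or every Schoenflies ball)
carries a transparent metric by a soft
argument (conformal collars, h-principle for escape functions): then RIGID_Σ is SPC4/Schoenflies
verbatim, the dynamics adds nothing,
close --reason superseded --by route-SmoothPoincare4-SchoenfliesSplit; (k2) ENCODING —
TransparentDomainContractible or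
ExpandingFieldTwisted refuted AS TYPED (e.g. a junk `IsGeodesic`, or convexity on ker dρ
mis-specifying glancing): repair by --restate
through the definition requests, not a close; two such bounces without a stable encoding ⇒ dormant;
(k3) if a grounder finds RIGID₄
or the lemma already in print with a negative twist (a transparent compact 4-manifold with ∂ = S³
used as a potential exotic ball),
re-rank: TRANSP_Σ becomes rank 2 and the route pivots to the negative side (file ¬RIGID_Σ-type
census statements).

NOT DECOMPOSED YET. - The lemma at full strength (∂D ↪ D is (n−1)-connected in every dimension;
CORK-TRAP over the tree's abstract `IsCork`/`BoundaryData`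
  manifolds-with-boundary) — needs the sphere-bundle exact sequence and metrics over `𝓡∂ 4`; only
the closed-manifold n = 4 shadow is filed.
- Scattering relation, lens data, Santaló's formula, conjugate points/Jacobi fields, escape
functions of fibre-degree ≥ 3 (the graded
  transparency ladder RIGID(1) ⊂ RIGID(3) ⊂ … whose union is RIGID_Σ by fibrewise polynomial
approximation of PSU 3.3.1(iii)) — need
  definitions first (requests below); they are layer-2 children of TransparentSpheresStandard.
- The 5-dimensional twin (transparent contractible W⁵ ⇒ ∂W ≅ S⁴; every homotopy 4-sphere bounds a
contractible W⁵) — Mathlib has no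
  manifold structure on regular level sets, so ∂W cannot yet be a `≃ₘ` subject.
- Perelman (∂D ≅ S³), Palais' disc theorem and Cerf Γ₄ = 0 are deliberately absorbed into the
conclusion `≃ₘ S⁴` of the cruxes so that
  the Assembly is fact-free and proved; they surface as explicit children only when
TransparentSpheresStandard is split.
- Special metrics for which RIGID_Σ is already a theorem (K ≤ 0 on D: no conjugate points ⇒ simple ⇒
ball, PSU 3.8.5–3.8.6; K ≥ 0 with
  convex boundary: soul argument) are not filed as items; they are calibrations a refuter may cite,
and they locate the open core of
  RIGID_Σ in metrics of mixed curvature.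

CHEAPEST FALSIFIER. (a) Lookup: a printed non-trapping strictly convex metric on a compact
4-manifold with ∂ = S³ that is not known to be B⁴, or the
statement RIGID₄ itself — searched PSU Ch. 3 (read pp. 57–67, 94–101), zbMATH ("non-trapping
manifold strictly convex boundary" 6 hits,
"scattering rigidity lens data" 4, SUV/Guillarmou/Croke–Herreros), galaxy "non-trapping metric" (10
rows): nothing on the topology of the
filling beyond 'contractible' and 'simple ⇒ ball'. (b) Experiment a refuter can run with kit:
integrate geodesics numerically for a
family of convex metrics on the Akbulut cork W (0h ∪ 1h ∪ 2h, ∂W = Σ(2,5,7)) and on the Mazur-type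
presentation of B⁴ with the same
handle count; the lemma predicts a trapped orbit in EVERY trial on W — one transparent-looking
metric on W falsifies the encoding or the
lemma at once. (c) Degeneracy check done by hand: TRANSP_Σ is not vacuous (S⁴ minus a small cap is
CONCAVE and traps great circles in
the round metric; transparency needs a genuinely different metric) and RIGID_Σ is not SPC4 in
disguise (the chart ball is the removed
piece E, never the transparent piece D).

NUMBERS. None load-bearing. Dimension count: 'transparent ⇒ ball' is a theorem for n ≤ 3 (disc;
Perelman) and n ≥ 6 (contractible + simply
connected boundary + h-cobordism), open exactly for n = 4 (RIGID_Σ) and n = 5. Escape-function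
degrees: 1 (rigid, ExpandingFieldTwisted),
3, 5, … (odd only: an escape function may be taken odd in v).

DEFINITION REQUESTS. - D1 `IsStrictlyConvexSublevel g ρ` (topic Literature/Geometry/Riemannian): 0
is a regular value of ρ and Hess_g ρ(v,v) > 0 for
  0 ≠ v ∈ ker dρ_x, ρ x = 0 — would shorten every item here to one line and serve
ConvexityLadder-type routes too.
- D2 `IsNonTrappingSublevel g ρ`: every complete geodesic of g.leviCivita with ρ(γ 0) ≤ 0 and γ'(0)
≠ 0 has ρ(γ t) > 0 for some t > 0.
- D3 (later, for L1/L2) `exitTime`, `scatteringRel` of a transparent sublevel on the inward boundary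
of the unit sphere bundle.
- Cite facts wanted (family spc4): PSU Prop 3.7.22 (transparent ⇒ contractible), Lemma 3.2.3 (exit
time continuous on SM under strict
  convexity), Prop 3.3.1 (non-trapping ⟺ escape function), Prop 3.8.5 (simple ⇒ diffeomorphic to a
closed ball).

Novelty: Searches (2026-08-15): `lit search --hybrid "non-trapping strictly convex boundary contractible
manifold exit time"` (12 docs; PSU held,
read PDF pp. 15–17, 57–67, 73, 94–101); zbMATH via `lit search --source zbmath`: "non-trapping
manifold strictly convex boundary" (6:
LassasSaksalaZhou2018, Eptaminitakis–Graham 2021, Holman–Uhlmann 2018, …), "scattering rigidity lens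
data" (4: CrokeHerreros2016,
Stefanov–Uhlmann 2009, Cekić–Guillarmou–Lefeuvre 2024, Yi–Zhang 2025), "Guillarmou lens rigidity
hyperbolic trapped" (2), "Stefanov
Uhlmann Vasy boundary rigidity" (4); `lit galaxy search "non-trapping metric" --star all` (10 rows:
PSU, Daudé–Häfner–Nicolas,
scattering/Strichartz pdfs), `"lens rigidity" --star all` and `"trapped set" --star pdf` (noise
only); `lit search --hybrid "exotic R4
neighborhood of infinity …"` (Kirby1989 Ch. XIV read, pp. 86–87); OpenAlex/S2/arXiv returned HTTP
429 all session (recorded); `ledger idea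
list` (128 cards: no other card with geodesic dynamics), `ledger negatives` (0). Nearest prior art
found: PaternainSaloUhlmann2023 Prop 3.7.22
+ Rem 3.7.23 (transparent ⇒ contractible; Serre 1951 Prop 13, Thorbergsson 1978 Thm 4.2), Prop 3.8.5
(simple ⇒ closed ball), Prop 3.3.1
(escape functions); StefanovUhlmannVasy2021 (arXiv:1702.03638), Guillarmou2016 (arXiv:1412.1760),
CrokeHerreros2016 (arXiv:1108.4938) —
lens data determine the METRIC on a KNOWN manifold; LassasSaksalaZhou2018 (arXiv:1708.07573) —
reconstruction of a compact manifold,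
topology included,  [refs: 1702.03638, 1412.1760, 1108.4938, 1708.07573, LassasSaksalaZhou2018, CrokeHerreros2016, Kirby1989, PaternainSaloUhlmann2023, StefanovUhlmannVasy2021, Guillarmou2016]

Barriers (technique_class: non-trapping-geodesics, lens-rigidity, ball-recognition): - technique_class: non-trapping-geodesics, lens-rigidity, ball-recognition
- Literature.Barriers.SmoothPoincare4.ContractibleBarrierFour: evaded by restriction, honestly —
transparency already FAILS for every compact contractible W⁴ with ∂W ≇ S³
(TransparentDomainContractible: the boundary of a transparent domain is simply connected), so no
rigidity is claimed for the Akbulut–Ruberman pairs; RIGID_Σ speaks only of ∂ = S³, where the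
barrier's witnesses do not live. The bet: a dynamical hypothesis on the metric can do for homotopy
balls what homeomorphism type cannot do for contractible manifolds.
- Literature.Barriers.SmoothPoincare4.RelativeContractibleBarrierFour: same — corks are exactly the
contractible manifolds the lemma certifies as opaque; nothing relative (extension of boundary
diffeomorphisms) is asserted.
- Literature.Barriers.SmoothPoincare4.OpenAnalogueBarrierFour: not triggered — every item quantifies
over the COMPACT sublevel D with convex boundary; nothing is inferred from an open ℝ⁴-homeomorph,
and the support ExpandingFieldTwisted concludes a compact statement (twisted sphere) rather than '{ρ
< 0} ≅ ℝ⁴' precisely to stay off the open analogue.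
- Literature.Barriers.SmoothPoincare4.TwistedSphereBarrierFour: used as the engine, not opposed —
the natural proof of RIGID_Σ ends in D ≅ D⁴ ⇒ Σ twisted ⇒ Cerf Γ₄ = 0; ExpandingFieldTwisted lands
literally on `IsTwistedSphere`.
- Literature.Barriers.SmoothPoincare4.HCobordismInvariantBarrierFour: transparency of a punc

Novelty grade: new-combination — ROUTE REVIEW (refuter) PASS w/ notes; new-combination (concur w/ card audit which READ PSU 3.7.22/3.8.5; no other SPC4 route uses geodesic dynamics; negatives 0). ELAB: tree file not materialised (rev0); RIGID_Σ/TRANSP_Σ re-typed verbatim from payload w/ the 6 imports (my W_TB.lean): rc0, assembly t (refuter refuter-rreview-route-SmoothPoincare4-Tr-ef8906bd-0, 2026-08-15T13:57:21Z; prior: PaternainSaloUhlmann2023 Prop3.7.22/3.8.5/3.3.1, arXiv:1702.03638, arXiv:1412.1760, arXiv:1108.4938, arXiv:1708.07573, Thorbergsson1978, Serre1951)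

History (route lifecycle, newest last):
- 2026-08-22T17:35:49Z · DORMANT — reconciler: no traction for 5.5 d (last activity item-evidence-added at 2026-08-17T04:19:21Z); parked, not closed — `ledger route dormant route-SmoothPoincare4- (operator:999:1661296)

sub-problem: SmoothPoincare4 · status: dormant · opened planner-plancard-SmoothPoincare4-SmoothPoinca-783c7a98-0 2026-08-15T12:05:49Z · rev 1 · ledger route-SmoothPoincare4-TransparentBalls
GENERATED by the gate from the ledger (D-0016/17). Provers cite these decls: `theorem foo : Summit.SmoothPoincare4.SmoothPoincare4.Theses.TransparentBalls.<Decl> := …` in Summits/SmoothPoincare4/SmoothPoincare4/Theorems/<Name>.lean.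
-/

namespace Summit.SmoothPoincare4.SmoothPoincare4.Theses.TransparentBalls

open scoped BigOperators Topology Manifold Classical MeasureTheory ProbabilityTheory Matrix InnerProductSpace ComplexConjugate ContinuousMap ContDiff
open Filter Set Function TopologicalSpace MeasureTheory

attribute [summit_statement] _root_.SmoothPoincare4

open Literature.SPC4

/-- item stmt-SmoothPoincare4-7263 · target · rank 0 · open · by planner
why it might fail: each conjunct is a consequence of SPC4, so X ⟺ SPC4: the split is honest but cannot be easier than the summit in total; its value is that the two halves belong to different communities (4-manifolds vs inverse problems).
sources: PaternainSaloUhlmann2023, Kirby1997, Cerf1968, FreedmanJDG1982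
[target] X = RIGID_Σ ∧ TRANSP_Σ, both conjuncts spelled out (the two crux bodies below, verbatim). -/
@[route_item "route-SmoothPoincare4-TransparentBalls"]
def TransparencyThesis : Prop :=
  (∀ (S : Literature.Topology.FourManifolds.HomotopySphere 4) (g : Literature.Geometry.Lorentzian.PseudoRiemannianMetric (𝓡 4) ∞ (EuclideanSpace ℝ (Fin 4)) (TangentSpace (𝓡 4) : S.carrier → Type _)) [g.HasLeviCivita] (p : S.carrier) (r : ℝ) (ρ : S.carrier → ℝ), g.IsRiemannian → ContMDiff (𝓡 4) 𝓘(ℝ, ℝ) ∞ ρ → 0 < r → Metric.closedBall (extChartAt (𝓡 4) p p) r ⊆ (extChartAt (𝓡 4) p).target → {x | 0 ≤ ρ x} = (extChartAt (𝓡 4) p).symm '' Metric.closedBall (extChartAt (𝓡 4) p p) r → (∀ x, ρ x = 0 → mfderiv (𝓡 4) 𝓘(ℝ, ℝ) ρ x ≠ 0) → (∀ x, ρ x = 0 → ∀ v : TangentSpace (𝓡 4) x, v ≠ 0 → mfderiv (𝓡 4) 𝓘(ℝ, ℝ) ρ x v = 0 → 0 < g.hessian ρ x v v) → (∀ γ :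 ℝ → S.carrier, Literature.Geometry.Lorentzian.IsGeodesic g.leviCivita γ → ρ (γ 0) ≤ 0 → Literature.Geometry.Lorentzian.velocity (𝓡 4) γ 0 ≠ 0 → ∃ t : ℝ, 0 < t ∧ 0 < ρ (γ t)) → Nonempty (S.carrier ≃ₘ⟮𝓡 4, 𝓡 4⟯ Metric.sphere (0 : EuclideanSpace ℝ (Fin 5)) 1)) ∧ (∀ S : Literature.Topology.FourManifolds.HomotopySphere 4, ∃ (g : Literature.Geometry.Lorentzian.PseudoRiemannianMetric (𝓡 4) ∞ (EuclideanSpace ℝ (Fin 4)) (TangentSpace (𝓡 4) : S.carrier → Type _)) (_ : g.HasLeviCivita) (p : S.carrier) (r : ℝ) (ρ : S.carrier → ℝ), g.IsRiemannian ∧ ContMDiff (𝓡 4) 𝓘(ℝ, ℝ) ∞ ρ ∧ 0 < r ∧ Metric.closedBall (extChartAt (𝓡 4) p p) r ⊆ (extChartAt (𝓡 4) p).target ∧ {x | 0 ≤ ρ x} = (extChartAt (𝓡 4) p).symm '' Metric.closedBall (extChartAt (𝓡 4) p p) r ∧ (∀ x, ρ x = 0 → mfderiv (𝓡 4) 𝓘(ℝ,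 ℝ) ρ x ≠ 0) ∧ (∀ x, ρ x = 0 → ∀ v : TangentSpace (𝓡 4) x, v ≠ 0 → mfderiv (𝓡 4) 𝓘(ℝ, ℝ) ρ x v = 0 → 0 < g.hessian ρ x v v) ∧ (∀ γ : ℝ → S.carrier, Literature.Geometry.Lorentzian.IsGeodesic g.leviCivita γ → ρ (γ 0) ≤ 0 → Literature.Geometry.Lorentzian.velocity (𝓡 4) γ 0 ≠ 0 → ∃ t : ℝ, 0 < t ∧ 0 < ρ (γ t)))

/-- item stmt-SmoothPoincare4-7264 · crux · rank 2 · open · by planner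
why it might fail: non-trapping + convex is C²-open and no obstruction beyond 'contractible, ∂ ≃ S³' is known: an exotic homotopy ball, if any exists, may simply carry a transparent metric (then RIGID_Σ is false and TRANSP_Σ true).
sources: PaternainSaloUhlmann2023, StefanovUhlmannVasy2021, Guillarmou2016, Cerf1968, FreedmanJDG1982
[crux] RIGID_Σ (card RIGID₄): for every homotopy 4-sphere Σ, Riemannian g with Levi-Civita
connection, point p, radius r > 0 with closedBall(chart p p, r) ⊆ chart target, and smooth ρ with {0
≤ ρ} = chart-preimage of that closed ball, 0 a regular value of ρ, ∂D = {ρ = 0} strictly convex from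
D = {ρ ≤ 0} (Hess_g ρ > 0 on ker dρ) and D non-trapping (every complete geodesic starting in D with
nonzero velocity reaches {ρ > 0} in positive time) — Σ is diffeomorphic to S⁴. [difficulty:
open-problem] -/
@[route_item "route-SmoothPoincare4-TransparentBalls", crux]
def TransparentSpheresStandard : Prop :=
  ∀ (S : Literature.Topology.FourManifolds.HomotopySphere 4) (g : Literature.Geometry.Lorentzian.PseudoRiemannianMetric (𝓡 4) ∞ (EuclideanSpace ℝ (Fin 4)) (TangentSpace (𝓡 4) : S.carrier → Type _)) [g.HasLeviCivita] (p : S.carrier) (r : ℝ) (ρ : S.carrier → ℝ), g.IsRiemannian → ContMDiff (𝓡 4) 𝓘(ℝ, ℝ) ∞ ρ → 0 < r → Metric.closedBall (extChartAt (𝓡 4) p p) r ⊆ (extChartAt (𝓡 4) p).target → {x | 0 ≤ ρ x} = (extChartAt (𝓡 4) p).symm '' Metric.closedBall (extChartAt (𝓡 4) p p) r → (∀ x, ρ x = 0 → mfderiv (𝓡 4) 𝓘(ℝ, ℝ) ρ x ≠ 0) → (∀ x, ρ x = 0 → ∀ v : TangentSpace (𝓡 4) x, v ≠ 0 → mfderiv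 (𝓡 4) 𝓘(ℝ, ℝ) ρ x v = 0 → 0 < g.hessian ρ x v v) → (∀ γ : ℝ → S.carrier, Literature.Geometry.Lorentzian.IsGeodesic g.leviCivita γ → ρ (γ 0) ≤ 0 → Literature.Geometry.Lorentzian.velocity (𝓡 4) γ 0 ≠ 0 → ∃ t : ℝ, 0 < t ∧ 0 < ρ (γ t)) → Nonempty (S.carrier ≃ₘ⟮𝓡 4, 𝓡 4⟯ Metric.sphere (0 : EuclideanSpace ℝ (Fin 5)) 1)

/-- item stmt-SmoothPoincare4-7265 · crux · rank 3 · open · by planner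
why it might fail: conversely every convex metric on an exotic puncture might trap — transparency could be as strong as a diffeomorphism to B⁴ (its degree-1 rung provably is: ExpandingFieldTwisted) — making TRANSP_Σ ⟺ SPC4 and RIGID_Σ vacuous.
sources: PaternainSaloUhlmann2023, CrokeHerreros2016, Kirby1997
[crux] TRANSP_Σ (card TRANSP): every homotopy 4-sphere Σ admits a Riemannian metric g (with
Levi-Civita connection), a point p, a radius r and a smooth ρ satisfying exactly the hypotheses of
TransparentSpheresStandard: co-ball {0 ≤ ρ} = chart-preimage of closedBall(chart p p, r) ⊆ target, 0
regular, ∂D strictly g-convex, D = {ρ ≤ 0} non-trapping. True for Σ = S⁴ (pull the flat unit-ball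
metric back to S⁴ minus a cap and extend). [difficulty: open-problem] -/
@[route_item "route-SmoothPoincare4-TransparentBalls", crux]
def PuncturedSpheresTransparent : Prop :=
  ∀ S : Literature.Topology.FourManifolds.HomotopySphere 4, ∃ (g : Literature.Geometry.Lorentzian.PseudoRiemannianMetric (𝓡 4) ∞ (EuclideanSpace ℝ (Fin 4)) (TangentSpace (𝓡 4) : S.carrier → Type _)) (_ : g.HasLeviCivita) (p : S.carrier) (r : ℝ) (ρ : S.carrier → ℝ), g.IsRiemannian ∧ ContMDiff (𝓡 4) 𝓘(ℝ, ℝ) ∞ ρ ∧ 0 < r ∧ Metric.closedBall (extChartAt (𝓡 4) p p) r ⊆ (extChartAt (𝓡 4) p).target ∧ {x | 0 ≤ ρ x} = (extChartAt (𝓡 4) p).symm '' Metric.closedBall (extChartAt (𝓡 4) p p) r ∧ (∀ x, ρ x = 0 → mfderiv (𝓡 4) 𝓘(ℝ, ℝ) ρ x ≠ 0) ∧ (∀ x, ρ x = 0 → ∀ v : TangentSpace (𝓡 4) x, v ≠ 0 → mfderiv (𝓡 4) 𝓘(ℝ, ℝ) ρ x v = 0 → 0 < g.hessian ρ x v v)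 ∧ (∀ γ : ℝ → S.carrier, Literature.Geometry.Lorentzian.IsGeodesic g.leviCivita γ → ρ (γ 0) ≤ 0 → Literature.Geometry.Lorentzian.velocity (𝓡 4) γ 0 ≠ 0 → ∃ t : ℝ, 0 < t ∧ 0 < ρ (γ t))

/-- item stmt-SmoothPoincare4-7266 · crux · rank 4 · open · by planner
why it might fail: dies with RIGID_Σ in the exotic-transparent scenario; and its own lever needs 'transparent contractible PRODUCT 5-manifolds are B⁵', a RIGID₅ nobody has — the non-trapping billiard on the double gives a cross-section, not yet a diffeomorphism.
sources: PaternainSaloUhlmann2023, KervaireMilnor1963, arXiv:2212.02004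
[crux] DOUBLE (card item 3(a), weaker than RIGID_Σ): under the hypotheses of
TransparentSpheresStandard, S⁴ is a connected sum Σ # Σ (tree `IsConnectedSum`, unoriented,
existential over the discs) — realised by the double D ∪_∂ D̄ = Σ # Σ̄ of the transparent puncture
along the removed chart balls. Equivalently D × [0,1] ≅ B⁵; it makes Σ invertible, i.e. feeds
SchoenfliesSplit.SchsplitInvertible with T = Σ, and it is the entry point for the 5-dimensional
lever (D × I with the convexly smoothed product metric is again transparent). [deps:
TransparentSpheresStandard] [difficulty: open-problem] -/
@[route_item "route-SmoothPoincare4-TransparentBalls"]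
def TransparentSpheresSelfInverse : Prop :=
  ∀ (S : Literature.Topology.FourManifolds.HomotopySphere 4) (g : Literature.Geometry.Lorentzian.PseudoRiemannianMetric (𝓡 4) ∞ (EuclideanSpace ℝ (Fin 4)) (TangentSpace (𝓡 4) : S.carrier → Type _)) [g.HasLeviCivita] (p : S.carrier) (r : ℝ) (ρ : S.carrier → ℝ), g.IsRiemannian → ContMDiff (𝓡 4) 𝓘(ℝ, ℝ) ∞ ρ → 0 < r → Metric.closedBall (extChartAt (𝓡 4) p p) r ⊆ (extChartAt (𝓡 4) p).target → {x | 0 ≤ ρ x} = (extChartAt (𝓡 4) p).symm '' Metric.closedBall (extChartAt (𝓡 4) p p) r → (∀ x, ρ x = 0 → mfderiv (𝓡 4) 𝓘(ℝ, ℝ) ρ x ≠ 0) → (∀ x, ρ x = 0 → ∀ v : TangentSpace (𝓡 4) x, v ≠ 0 → mfderiv (𝓡 4) 𝓘(ℝ, ℝ) ρ x v = 0 → 0 < g.hessian ρ x v v) → (∀ γ : ℝ → S.carrier, Literature.Geometry.Lorentzian.IsGeodesic g.leviCivita γ → ρ (γ 0) ≤ 0 → Literature.Geometry.Lorentzian.velocity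 (𝓡 4) γ 0 ≠ 0 → ∃ t : ℝ, 0 < t ∧ 0 < ρ (γ t)) → Literature.Topology.FourManifolds.IsConnectedSum (𝓡 4) (𝓡 4) (𝓡 4) S.carrier S.carrier (Metric.sphere (0 : EuclideanSpace ℝ (Fin 5)) 1)

/-- item stmt-SmoothPoincare4-7267 · support · rank 9 · open · by planner
sources: PaternainSaloUhlmann2023, Milnor1965, KervaireMilnor1963
[support] DEGREE-1 TRANSPARENCY IS RIGID (calibration of the encoding; the k = 1 rung of PSU Prop
3.3.1(iii) with escape function f(x,v) = g(V_x, v)): if the puncture D = {ρ ≤ 0} (co-ball, 0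
regular) carries a smooth vector field V with g(∇_w V, w) > 0 for all x ∈ D, w ≠ 0 (½ L_V g positive
definite) and dρ(V) > 0 on ∂D (V outward), then Σ is a twisted sphere D⁴ ∪_φ D⁴ (hence ≅ S⁴ by
`cerf_twistedSphere_four`, not assumed here). Proof: −V preserves D, contracts intrinsic lengths by
e^(−ct), so ψ_t(D) shrinks to a unique zero x₀ ∈ D°, a nondegenerate source; a small chart sphere
around x₀ is V-transverse and its V-flow-out reaches ∂D transversally in finite time, so D = ball ∪
collar ≅ D⁴ and Σ = D ∪ E. Boundary convexity is not needed; such (g,V) is automatically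
non-trapping. [difficulty: XL] -/
@[route_item "route-SmoothPoincare4-TransparentBalls"]
def ExpandingFieldTwisted : Prop :=
  ∀ (S : Literature.Topology.FourManifolds.HomotopySphere 4) (g : Literature.Geometry.Lorentzian.PseudoRiemannianMetric (𝓡 4) ∞ (EuclideanSpace ℝ (Fin 4)) (TangentSpace (𝓡 4) : S.carrier → Type _)) [g.HasLeviCivita] (p : S.carrier) (r : ℝ) (ρ : S.carrier → ℝ) (V : Π x : S.carrier, TangentSpace (𝓡 4) x), g.IsRiemannian → ContMDiff (𝓡 4) 𝓘(ℝ, ℝ) ∞ ρ → 0 < r → Metric.closedBall (extChartAt (𝓡 4) p p) r ⊆ (extChartAt (𝓡 4) p).target → {x | 0 ≤ ρ x} = (extChartAt (𝓡 4) p).symm '' Metric.closedBall (extChartAt (𝓡 4) p p) r → (∀ x, ρ x = 0 → mfderiv (𝓡 4) 𝓘(ℝ, ℝ) ρ x ≠ 0) → ContMDiff (𝓡 4) (𝓡 4).tangent ∞ (T% V) → (∀ x, ρ x ≤ 0 → ∀ w : TangentSpace (𝓡 4) x, w ≠ 0 → 0 < g.val x (g.leviCivita V x w) w) → (∀ x,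 ρ x = 0 → (0 : ℝ) < (mfderiv (𝓡 4) 𝓘(ℝ, ℝ) ρ x (V x) : ℝ)) → ∃ φ : (Metric.sphere (0 : EuclideanSpace ℝ (Fin 4)) 1) ≃ₘ⟮𝓡 3, 𝓡 3⟯ (Metric.sphere (0 : EuclideanSpace ℝ (Fin 4)) 1), Literature.Topology.FourManifolds.IsTwistedSphere 3 φ S.carrier

/-- item stmt-SmoothPoincare4-7268 · support · rank 9 · open · by planner
sources: PaternainSaloUhlmann2023, StefanovUhlmannVasy2021
[support] THE CARD'S LEMMA, dimension 4, closed-manifold form (CORK-TRAP): in any closed smooth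
Riemannian 4-manifold M, a connected regular sublevel domain D = {ρ ≤ 0} with strictly convex
boundary and no trapped geodesic is contractible and its boundary {ρ = 0} is simply connected (hence
a homotopy 3-sphere; so every cork, Mazur manifold, knot trace or domain with H₂ ≠ 0 traps in every
convex metric). Proof: PSU Prop 3.7.22 (Serre: non-contractible ⇒ geodesic chords of unbounded
length, contradicting the uniform escape time) gives contractibility; the backward flow to the
boundary, with exit time continuous by strict convexity (PSU Lemma 3.2.3), deformation-retracts SD
onto ∂₊SD ≃ ∂D, so ∂D → D factors through the S³-bundle SD → D and is 3-connected; hence π₁(∂D) ≅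
π₁(D) = 1 and π₂(∂D) = 0, i.e. ∂D is a homotopy 3-sphere (the item records contractibility and
π₁(∂D) = 1). [difficulty: XL] -/
@[route_item "route-SmoothPoincare4-TransparentBalls"]
def TransparentDomainContractible : Prop :=
  ∀ (M : Type) [TopologicalSpace M] [T2Space M] [SecondCountableTopology M] [CompactSpace M] [ChartedSpace (EuclideanSpace ℝ (Fin 4)) M] [IsManifold (𝓡 4) ∞ M] (g : Literature.Geometry.Lorentzian.PseudoRiemannianMetric (𝓡 4) ∞ (EuclideanSpace ℝ (Fin 4)) (TangentSpace (𝓡 4) : M → Type _)) [g.HasLeviCivita] (ρ : M → ℝ), g.IsRiemannian → ContMDiff (𝓡 4) 𝓘(ℝ, ℝ) ∞ ρ → (∃ x, ρ x < 0) → (∀ x, ρ x = 0 → mfderiv (𝓡 4) 𝓘(ℝ, ℝ) ρ x ≠ 0) → (∀ x, ρ x = 0 → ∀ v : TangentSpace (𝓡 4) x, v ≠ 0 → mfderiv (𝓡 4) 𝓘(ℝ, ℝ) ρ x v = 0 → 0 < g.hessian ρ x v v) → (∀ γ : ℝ → M, Literature.Geometry.Lorentzian.IsGeodesic g.leviCivita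 γ → ρ (γ 0) ≤ 0 → Literature.Geometry.Lorentzian.velocity (𝓡 4) γ 0 ≠ 0 → ∃ t : ℝ, 0 < t ∧ 0 < ρ (γ t)) → IsConnected {x | ρ x ≤ 0} → ContractibleSpace {x // ρ x ≤ 0} ∧ SimplyConnectedSpace {x // ρ x = 0}

/-- item stmt-SmoothPoincare4-7269 · assembly · rank 1 · open · by planner
sources: KervaireMilnor1963, FreedmanJDG1982
[assembly] TransparentSpheresStandard → PuncturedSpheresTransparent → SmoothPoincare4 (for each Σ
take the transparent puncture from TRANSP_Σ, apply RIGID_Σ, then the homotopy-sphere reduction). -/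
@[route_item "route-SmoothPoincare4-TransparentBalls"]
def Assembly : Prop :=
  TransparentSpheresStandard → PuncturedSpheresTransparent → SmoothPoincare4

/-! D-0027 §2.1 — DECIDING THEOREM (planner-authored via `route open/edit --closes-file`; by planner-rbadge-SmoothPoincare4-TransparentBall-27b35d05-g4-0 2026-08-15T16:21:18Z):
its hypotheses are this route's items and its conclusion the sub-problem Statement (glue_lint), and it elaborates with this file. -/

@[closes "route-SmoothPoincare4-TransparentBalls"] theorem closes (hR : TransparentSpheresStandard) (hT : PuncturedSpheresTransparent) :
    _root_.SmoothPoincare4 := by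
  intro M _ _ _ _ _ e
  haveI : CompactSpace M :=
    Literature.Topology.FourManifolds.compactSpace_of_homotopyEquiv_sphere_four_holds M e
  obtain ⟨o⟩ :=
    Literature.Topology.FourManifolds.isOrientable_of_homotopyEquiv_sphere_four_holds M e
  obtain ⟨g, hLC, p, r, ρ, h1, h2, h3, h4, h5, h6, h7, h8⟩ := hT ⟨M, o, ⟨e⟩⟩
  haveI := hLC
  exact hR _ g p r ρ h1 h2 h3 h4 h5 h6 h7 h8

end Summit.SmoothPoincare4.SmoothPoincare4.Theses.TransparentBalls
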